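import Literature.Computability.Complexity.CircuitPlug
import Literature.Computability.Complexity.Williams2014Lemma31
import Literature.Computability.Complexity.AccFanIn
import HarnessLib

/-!
# Williams' Theorem 3.2, explicit SAT instance: preliminaries

Preliminaries for `Williams2014SatInstance.lean`, which builds the `ACC`-SAT instance `D` of
Williams 2014, Thm. 3.2 (pp. 12–13) as an EXPLICIT circuit (the verifier `B`, named fact
`Williams2014_thm_3_2_machineB` of `Williams2014Lemma31.lean`, must print its code):

* two more data-level appenders for the calculus of `CircuitPlug.lean`: prefix transport
  `Carries.of_prefix`, the ternary disjunction `or₃Wire`, and the six-gate **slot test**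
  `addSlot` computing `p ∧ (a ↔ s)` from the occupancy wire `p`, the witness-value wire `a`
  and the polarity wire `s` of a literal slot (Williams 2014, p. 13: "`D` compares the sign
  bits with the bits output by the copies of `W`"), with `carries_addSlot` (depth `+ 3`),
  `wf_addSlot`, `fn_mem_addSlot`, `length_addSlot`, `prefix_addSlot`;
* `Circuit.normFanIn m C` — fan-in normalisation as a FUNCTION (the circuit built inside the
  proof of `Circuit.exists_normFanIn`, `AccFanIn.lean`) with `eval_normFanIn`,
  `acDepth_normFanIn_le`, `size_normFanIn`, `isOver_normFanIn`, `maxFanIn_normFanIn_le`;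
* the arithmetic of print positions of clause coordinates (`clauseCoordList`,
  `Williams2014Lemma31.lean`: slot-major, then occupancy, polarity, index bits):
  `fieldPos`, `coordPos κ = ℓ (w + 2) + fieldPos`, the inverse `coordOf` on `Fin (3 (w + 2))`,
  `coordOf_coordPos`, `coordPos_coordOf`, `getElem_clauseCoordList_coordPos` (the coordinate printed at
  position `coordPos κ` is `κ`) and `clauseCoordList_eq_ofFn` (the print order IS the `coordOf`
  order) — what a machine needs to locate the code of `G κ` in a printout.

Everything is proved.

## References

* R. Williams, *Nonuniform ACC circuit lower bounds*, J. ACM 61(1) (2014) 2:1–2:32, proof of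
  Thm. 3.2 (pp. 12–13) [Williams2014].
* H. Vollmer, *Introduction to Circuit Complexity*, Springer 1999, §1.2 [Vollmer1999].
-/

namespace Literature.Computability.Complexity

namespace GateList

open Finset

variable {ι : Type*}

/-! ### Two more appenders: prefix transport, ternary `∨`, the slot test -/

/-- A wire of a prefix of a program is the same wire of the program. [folklore] -/
theorem Carries.of_prefix {gs gs' : List (Gate ι)} {u : ι ⊕ ℕ} {f : (ι → Bool) → Bool} {d : ℕ}
    (h : Carries gs u f d) (hp : gs <+: gs') : Carries gs' u f d := by
  obtain ⟨more, rfl⟩ := hp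
  exact h.append more

/-- Append the ternary disjunction of three wires. [cite: Vollmer1999, §1.2] -/
def or₃Wire (gs : List (Gate ι)) (u v t : ι ⊕ ℕ) : List (Gate ι) × (ι ⊕ ℕ) :=
  (gs ++ [bigGate false 3 ![u, v, t]], Sum.inr gs.length)

/-- **Disjunction of three carried wires**: depth `+ 1`. [cite: Vollmer1999, §1.2] -/
theorem carries_or₃Wire {gs : List (Gate ι)} {u v t : ι ⊕ ℕ} {f g k : (ι → Bool) → Bool} {d : ℕ}
    (hu : Carries gs u f d) (hv : Carries gs v g d) (ht : Carries gs t k d) :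
    Carries (or₃Wire gs u v t).1 (or₃Wire gs u v t).2 (fun x => f x || g x || k x) (d + 1) := by
  refine carries_snoc gs _ (fun x => ?_) ?_
  · simp [bigGate, GateFn.or, Fin.exists_fin_succ, hu.eval x, hv.eval x, ht.eval x, Bool.or_assoc]
  · rw [bigGate_fn, if_neg Bool.false_ne_true, acWeight_or, add_comm]
    refine Nat.add_le_add_right (Finset.sup_le fun a _ => ?_) 1
    fin_cases a
    · exact hu.depth
    · exact hv.depth
    · exact ht.depth

/-- Well-formedness of the ternary appender. [folklore] -/
theorem wf_or₃Wire {gs : List (Gate ι)} (hwf : WF gs) {u v t : ι ⊕ ℕ} (hu : OutOK gs.length u)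
    (hv : OutOK gs.length v) (ht : OutOK gs.length t) : WF (or₃Wire gs u v t).1 :=
  wf_snoc hwf fun a => by fin_cases a <;> simpa [bigGate]

/-- The ternary appender adds one gate of `acBasis`. [folklore] -/
theorem fn_mem_or₃Wire {B : Set GateFn} (hB : acBasis ⊆ B) {gs : List (Gate ι)}
    (h : ∀ g ∈ gs, g.fn ∈ B) (u v t : ι ⊕ ℕ) : ∀ g ∈ (or₃Wire gs u v t).1, g.fn ∈ B :=
  fn_mem_snoc h (by rw [bigGate_fn, if_neg Bool.false_ne_true]; exact hB (or_mem_acBasis 3))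

/-- **The slot test** `p ∧ (a ↔ s)` on three wires, as six gates: `a ∧ s`, `¬a`, `¬s`,
`¬a ∧ ¬s`, `(a ∧ s) ∨ (¬a ∧ ¬s)`, `p ∧ (…)` (Williams 2014, p. 13: "compares the sign bits
with the bits output by the copies of `W`"). [cite: Williams2014, proof of Thm. 3.2 (p. 13)] -/
def addSlot (gs : List (Gate ι)) (a s p : ι ⊕ ℕ) : List (Gate ι) × (ι ⊕ ℕ) :=
  let r1 := andWire gs a s
  let r2 := notWire r1.1 a
  let r3 := notWire r2.1 s
  let r4 := andWire r3.1 r2.2 r3.2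
  let r5 := orWire r4.1 r1.2 r4.2
  andWire r5.1 p r5.2

/-- The slot test appends six gates. [folklore] -/
@[simp] theorem length_addSlot (gs : List (Gate ι)) (a s p : ι ⊕ ℕ) :
    (addSlot gs a s p).1.length = gs.length + 6 := by
  simp [addSlot]

/-- The program is a prefix of the slot test. [folklore] -/
theorem prefix_addSlot (gs : List (Gate ι)) (a s p : ι ⊕ ℕ) : gs <+: (addSlot gs a s p).1 := by
  simp only [addSlot, andWire, orWire, notWire, List.append_assoc]
  exact List.prefix_append _ _

/-- **Semantics and depth of the slot test**: depth `+ 3`. [cite: Williams2014, proof of Thm. 3.2 (p. 13)] -/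
theorem carries_addSlot {gs : List (Gate ι)} {a s p : ι ⊕ ℕ} {fa fs fp : (ι → Bool) → Bool}
    {d : ℕ} (ha : Carries gs a fa d) (hs : Carries gs s fs d) (hp : Carries gs p fp d) :
    Carries (addSlot gs a s p).1 (addSlot gs a s p).2 (fun x => fp x && decide (fa x = fs x))
      (d + 3) := by
  have h1 := carries_andWire ha hs
  have h2 := carries_notWire (ha.andWire a s)
  have h3 := carries_notWire ((hs.andWire a s).notWire a)
  have h4 := carries_andWire (h2.notWire s) h3
  have h5 := carries_orWire (((h1.notWire a).notWire s).andWire _ _) h4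
  have hp' : Carries (orWire (andWire (notWire (notWire (andWire gs a s).1 a).1 s).1
      (notWire (andWire gs a s).1 a).2 (notWire (notWire (andWire gs a s).1 a).1 s).2).1
        (andWire gs a s).2 (andWire (notWire (notWire (andWire gs a s).1 a).1 s).1
          (notWire (andWire gs a s).1 a).2 (notWire (notWire (andWire gs a s).1 a).1 s).2).2).1
      p fp (d + 2) :=
    (((((hp.andWire a s).notWire a).notWire s).andWire _ _).orWire _ _).mono (by omega)
  have h6 := carries_andWire hp' h5
  refine (h6.congr fun x => ?_).mono le_rfl
  cases fa x <;> cases fs x <;> cases fp x <;> rfl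

/-- Well-formedness of the slot test. [folklore] -/
theorem wf_addSlot {gs : List (Gate ι)} (hwf : WF gs) {a s p : ι ⊕ ℕ} (ha : OutOK gs.length a)
    (hs : OutOK gs.length s) (hp : OutOK gs.length p) : WF (addSlot gs a s p).1 := by
  have ha1 : ∀ n, gs.length ≤ n → OutOK n a := fun n hn m hm => (ha m hm).trans_le hn
  have hs1 : ∀ n, gs.length ≤ n → OutOK n s := fun n hn m hm => (hs m hm).trans_le hn
  have hp1 : ∀ n, gs.length ≤ n → OutOK n p := fun n hn m hm => (hp m hm).trans_le hn
  refine wf_andWire (wf_orWire (wf_andWire (wf_notWire (wf_notWire (wf_andWire hwf ha hs)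
    (ha1 _ (by simp only [length_andWire]; omega)))
    (hs1 _ (by simp only [length_andWire, length_notWire]; omega))) ?_ ?_) ?_ ?_)
    (hp1 _ (by simp only [length_andWire, length_notWire, length_orWire]; omega)) ?_
  all_goals
    intro m hm
    simp only [andWire, orWire, notWire, Sum.inr.injEq] at hm
    subst hm
    simp only [length_andWire, length_notWire, length_orWire, List.length_append,
      List.length_singleton]
    omega

/-- The slot test adds gates of `acBasis`. [folklore] -/
theorem fn_mem_addSlot {B : Set GateFn} (hB : acBasis ⊆ B) {gs : List (Gate ι)}
    (h : ∀ g ∈ gs, g.fn ∈ B) (a s p : ι ⊕ ℕ) : ∀ g ∈ (addSlot gs a s p).1, g.fn ∈ B :=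
  fn_mem_andWire hB (fn_mem_orWire hB (fn_mem_andWire hB (fn_mem_notWire hB
    (fn_mem_notWire hB (fn_mem_andWire hB h _ _) _) _) _ _) _ _) _ _

end GateList

open GateList

open GateList

/-! ### Def-level fan-in normalisation -/

/-- **Fan-in normalisation as a function** (the circuit built in the proof of
`Circuit.exists_normFanIn`, `AccFanIn.lean`): every gate normalised (`Gate.normFanIn`), same
output wire. [folklore] -/
noncomputable def Circuit.normFanIn {n : ℕ} (m : ℕ) (C : Circuit (Fin n)) : Circuit (Fin n) :=
  GateList.toCircuit (C.gates.map (Gate.normFanIn m)) C.output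
    (wf_map_normFanIn m (wf_gates C)) fun m' h => by
      rw [List.length_map]; exact C.wf_output m' h

/-- The normalised circuit has the same number of gates. [folklore] -/
@[simp] theorem Circuit.size_normFanIn {n : ℕ} (m : ℕ) (C : Circuit (Fin n)) :
    (C.normFanIn m).size = C.size := by
  simp [Circuit.normFanIn, GateList.toCircuit, Circuit.size]

/-- The normalised circuit computes the same function. [folklore] -/
theorem Circuit.eval_normFanIn {n : ℕ} (m : ℕ) (C : Circuit (Fin n)) (x : Fin n → Bool) :
    (C.normFanIn m).eval x = C.eval x := by
  rw [Circuit.normFanIn, circuit_eval, circuit_eval]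
  change wireOf x (vals (C.gates.map (Gate.normFanIn m)) x) C.output = _
  rw [vals_map_normFanIn]

/-- The normalised circuit is no deeper. [folklore] -/
theorem Circuit.acDepth_normFanIn_le {n : ℕ} (m : ℕ) (C : Circuit (Fin n)) :
    (C.normFanIn m).acDepth ≤ C.acDepth := by
  change Circuit.depthWith _ acWeight ≤ Circuit.depthWith _ acWeight
  rw [circuit_depthWith, circuit_depthWith]
  exact wireDepthOf_le_of_getD_le (getD_wdepths_map_normFanIn_le m C.gates) C.output

/-- The normalised circuit stays over `accBasis m`. [folklore] -/
theorem Circuit.isOver_normFanIn {n m : ℕ} {C : Circuit (Fin n)} (hC : C.IsOver (accBasis m)) :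
    (C.normFanIn m).IsOver (accBasis m) := by
  intro g' hg'
  change g' ∈ C.gates.map (Gate.normFanIn m) at hg'
  obtain ⟨g, hg, rfl⟩ := List.mem_map.1 hg'
  exact Gate.normFanIn_fn_mem (hC g hg)

/-- The normalised circuit has fan-in `≤ m (n + size)` (`0 < m`). [folklore] -/
theorem Circuit.maxFanIn_normFanIn_le {n m : ℕ} (hm : 0 < m) {C : Circuit (Fin n)}
    (hC : C.IsOver (accBasis m)) : (C.normFanIn m).maxFanIn ≤ m * (n + C.size) := by
  refine Circuit.maxFanIn_le_of_forall _ fun g' hg' => ?_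
  change g' ∈ C.gates.map (Gate.normFanIn m) at hg'
  obtain ⟨g, hg, rfl⟩ := List.mem_map.1 hg'
  obtain ⟨j, hj, rfl⟩ := List.mem_iff_getElem.1 hg
  have hok : GateOK j C.gates[j] := wf_gates C j _ (List.getElem?_eq_getElem hj)
  refine (Gate.arity_normFanIn_le hm (hC _ (List.getElem_mem hj)) hok).trans ?_
  have : j + 1 ≤ C.size := hj
  calc m * (n + j) + 1 ≤ m * (n + j) + m := Nat.add_le_add_left hm _
    _ = m * (n + (j + 1)) := by ring
    _ ≤ m * (n + C.size) := Nat.mul_le_mul_left m (Nat.add_le_add_left this n)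


/-! ### Print positions of clause coordinates -/

namespace WitnessCheck

section Coord


variable {w : ℕ}

/-- The position of the field of a clause coordinate inside its slot block: occupancy `0`,
polarity `1`, index bit `j` at `j + 2` (the order of `clauseCoordList`). [folklore] -/
def fieldPos : Bool ⊕ Fin w → ℕ
  | Sum.inl false => 0
  | Sum.inl true => 1
  | Sum.inr j => (j : ℕ) + 2

/-- Field positions are `< w + 2`. [folklore] -/
theorem fieldPos_lt (f : Bool ⊕ Fin w) : fieldPos f < w + 2 := by
  rcases f with (_ | _) | j
  · exact Nat.succ_pos _
  · simp [fieldPos]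
  · simp [fieldPos]

/-- **The position of a clause coordinate** (slot-major, then field): `ℓ (w + 2) + fieldPos`.
[folklore] -/
def coordPos (κ : ClauseCoord w) : ℕ := (κ.1 : ℕ) * (w + 2) + fieldPos κ.2

/-- Positions are `< 3 (w + 2)`. [folklore] -/
theorem coordPos_lt (κ : ClauseCoord w) : coordPos κ < 3 * (w + 2) := by
  have h1 : (κ.1 : ℕ) ≤ 2 := Nat.le_of_lt_succ κ.1.2
  have h2 := fieldPos_lt κ.2
  unfold coordPos
  nlinarith

/-- The field at a position inside a slot block. [folklore] -/
def fieldOf (r : ℕ) (hr : r < w + 2) : Bool ⊕ Fin w :=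
  if h0 : r = 0 then Sum.inl false else if h1 : r = 1 then Sum.inl true else Sum.inr ⟨r - 2, by omega⟩

/-- `fieldOf` inverts `fieldPos`. [folklore] -/
theorem fieldOf_fieldPos (f : Bool ⊕ Fin w) : fieldOf (fieldPos f) (fieldPos_lt f) = f := by
  rcases f with (_ | _) | j
  · simp [fieldOf, fieldPos]
  · simp [fieldOf, fieldPos]
  · simp [fieldOf, fieldPos]

/-- **The clause coordinate at a position** (inverse of `coordPos`). [folklore] -/
def coordOf (k : Fin (3 * (w + 2))) : ClauseCoord w :=
  (⟨(k : ℕ) / (w + 2), (Nat.div_lt_iff_lt_mul (Nat.succ_pos _)).2 (by simpa [Nat.mul_comm] using k.2)⟩,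
    fieldOf ((k : ℕ) % (w + 2)) (Nat.mod_lt _ (Nat.succ_pos _)))

/-- `coordOf` inverts `coordPos`. [folklore] -/
theorem coordOf_coordPos (κ : ClauseCoord w) : coordOf ⟨coordPos κ, coordPos_lt κ⟩ = κ := by
  obtain ⟨ℓ, f⟩ := κ
  have hr := fieldPos_lt f
  have hdiv : ((ℓ : ℕ) * (w + 2) + fieldPos f) / (w + 2) = ℓ := by
    rw [Nat.add_comm, Nat.add_mul_div_right _ _ (Nat.succ_pos _), Nat.div_eq_of_lt hr, Nat.zero_add]
  have hmod : ((ℓ : ℕ) * (w + 2) + fieldPos f) % (w + 2) = fieldPos f := by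
    rw [Nat.add_comm, Nat.add_mul_mod_self_right, Nat.mod_eq_of_lt hr]
  simp only [coordOf, coordPos, Prod.mk.injEq]
  refine ⟨Fin.ext hdiv, ?_⟩
  have : ∀ (r : ℕ) (hr' : r < w + 2), r = fieldPos f → fieldOf r hr' = f := by
    rintro r hr' rfl
    exact fieldOf_fieldPos f
  exact this _ _ hmod

/-! #### The print order is the `coordOf` order -/

/-- Indexing into a `flatMap` with blocks of uniform length `n`: position `i n + r` is entry `r`
of block `i`. [folklore] -/
theorem getElem_flatMap_blocks {α β : Type*} (f : α → List β) (n : ℕ) (hf : ∀ a, (f a).length = n) :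
    ∀ (L : List α) (i r j : ℕ) (hi : i < L.length) (hr : r < n) (hj : j = i * n + r)
      (h : j < (L.flatMap f).length), (L.flatMap f)[j] = (f L[i])[r]'(by rw [hf]; exact hr)
  | [], i, r, j, hi, _, _, _ => absurd hi (Nat.not_lt_zero _)
  | a :: L, 0, r, j, _, hr, hj, h => by
    subst hj
    simp only [List.flatMap_cons, List.getElem_cons_zero, Nat.zero_mul, Nat.zero_add]
    exact List.getElem_append_left (by rw [hf]; exact hr)
  | a :: L, i + 1, r, j, hi, hr, hj, h => by
    simp only [List.flatMap_cons, List.getElem_cons_succ]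
    have hfa := hf a
    have hj' : j = (f a).length + (i * n + r) := by rw [hj, hfa, Nat.succ_mul]; omega
    have hle : (f a).length ≤ j := by omega
    rw [List.getElem_append_right hle]
    exact getElem_flatMap_blocks f n hf L i r (j - (f a).length)
      (by simpa using hi) hr (by omega) _

/-- `fieldPos` inverts `fieldOf`. [folklore] -/
theorem fieldPos_fieldOf (r : ℕ) (hr : r < w + 2) : fieldPos (fieldOf r hr : Bool ⊕ Fin w) = r := by
  unfold fieldOf
  split_ifs with h0 h1
  · simp [fieldPos, h0]
  · simp [fieldPos, h1]
  · simp only [fieldPos]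
    omega

/-- `coordPos` inverts `coordOf`. [folklore] -/
theorem coordPos_coordOf (k : Fin (3 * (w + 2))) : coordPos (coordOf k : ClauseCoord w) = k := by
  simp only [coordPos, coordOf, fieldPos_fieldOf]
  exact Nat.div_add_mod' (k : ℕ) (w + 2)

/-- **The coordinate printed at position `coordPos κ` is `κ`** (`clauseCoordList`,
`Williams2014Lemma31.lean`). [folklore] -/
theorem getElem_clauseCoordList_coordPos (κ : ClauseCoord w)
    (h : coordPos κ < (clauseCoordList w).length := by rw [length_clauseCoordList]; exact coordPos_lt _) :
    (clauseCoordList w)[coordPos κ] = κ := by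
  obtain ⟨ℓ, f⟩ := κ
  have hblk : ∀ ℓ' : Fin 3, ((ℓ', Sum.inl false) :: (ℓ', Sum.inl true) ::
      (List.finRange w).map fun j => ((ℓ', Sum.inr j) : ClauseCoord w)).length = w + 2 := by
    intro ℓ'; simp
  have key := getElem_flatMap_blocks
    (fun ℓ' : Fin 3 => (ℓ', Sum.inl false) :: (ℓ', Sum.inl true) ::
      (List.finRange w).map fun j => ((ℓ', Sum.inr j) : ClauseCoord w))
    (w + 2) hblk (List.finRange 3) ℓ (fieldPos f) (coordPos (ℓ, f)) (by simp) (fieldPos_lt f) rfl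
    (by simpa [clauseCoordList] using h)
  change (clauseCoordList w)[coordPos (ℓ, f)] = _
  have hcl : clauseCoordList w = (List.finRange 3).flatMap fun ℓ' : Fin 3 =>
      (ℓ', Sum.inl false) :: (ℓ', Sum.inl true) ::
        (List.finRange w).map fun j => ((ℓ', Sum.inr j) : ClauseCoord w) := rfl
  simp only [hcl]
  rw [key, List.getElem_finRange]
  rcases f with (_ | _) | j
  · rfl
  · rfl
  · simp [fieldPos, Fin.ext_iff]

/-- **The print order of `clauseCoordList` is the order `coordOf`.** [folklore] -/
theorem clauseCoordList_eq_ofFn (w : ℕ) :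
    clauseCoordList w = List.ofFn fun k : Fin (3 * (w + 2)) => coordOf k := by
  apply List.ext_getElem
  · rw [length_clauseCoordList, List.length_ofFn]
  · intro k h1 h2
    rw [List.getElem_ofFn]
    have hk : k < 3 * (w + 2) := by rw [List.length_ofFn] at h2; exact h2
    have := getElem_clauseCoordList_coordPos (coordOf ⟨k, hk⟩ : ClauseCoord w)
    simp only [coordPos_coordOf] at this
    exact this

end Coord

end WitnessCheck

end Literature.Computability.Complexity
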